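import Summits.BirchSwinnertonDyer.BirchSwinnertonDyer.Theses.SignedLowerHalves
import Summits.BirchSwinnertonDyer.BirchSwinnertonDyer.Theorems.SprungSharpFlatMainConjectureEdges
import Summits.BirchSwinnertonDyer.BirchSwinnertonDyer.Theorems.SignedLowerHalvesSprungLowerHalfAtThreeChromaticReduction
import Summits.BirchSwinnertonDyer.Rank1Residual.Supersingular.SignedSqueezeX7
import Literature.NumberTheory.EllipticCurves.Wuthrich2014.ThreeAdicImageSupersingularProofs
import Literature.NumberTheory.EllipticCurves.Sprung2012.SharpFlatKatoDivisibility
import HarnessLib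

/-!
# Route `SignedLowerHalves`, crux child K1 `SprungLowerDivisibilityAtThree` (stmt-BirchSwinnertonDyer-19875)
# on the BIG-IMAGE branch of corner X8, EVERY analytic rank: the Eisenstein half IS the full ♯/♭ main
# conjecture there — Kato's half (Sprung 2012 Thm. 7.16) is integral under `surj(3)`
# (cell `bsd-print-x8`, D-0131 (2) print tier, prover seat p2; `--supports` 19875, closes nothing)

PARTITION (cell bsd-print-x8 / bsd-ssimc row A8): corner X8 = `ClassX8 W p` (`p = 3`, good
supersingular, `a₃ = ±3`) ∩ {`ρ̄_{E,3}` surjective} — 156 of the 217 census cells of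
`A8_x8_open_cells.v3.tsv` (82 of analytic rank `0`, 74 of analytic rank `1`); types-the-object-of K1
on that branch; closes NONE; 0 census moves; BSD is not proved by any of this.

HONEST FRAMING. Seat p2 of the print cell carries «♯♭ ⊇-half from Kato via Sprung's ♯♭ Coleman maps +
♯♭ control ⇒ r0 upper bound; unit cells close outright; r1 needs a ♯♭ `p`-adic Gross–Zagier — if none
in print it is the named residual crux». Its companion file `Rank1Residual/WAll/CornerX8Print.lean`
reads the sentence in Miller's currency (W-ALL row 8 ⟺ lower half on `surj(3)` ∧ whole `3`-part off
`surj(3)`, modulo Perrin-Riou 2003 Prop. 4.8, Kobayashi 2013 ∘ Perrin-Riou 2003 Prop. 4.20, GZK,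
modularity). THIS file reads it in Sprung's `Λ`-adic currency, on the REAL `X^•(E/ℚ_∞)`
(`Sprung2012.SharpFlatSelmerDualData`), and RANK-FREE:

* `X8.sprungSharpFlatMainConjecture_of_lowerDivisibility_of_surj` — **at an X8 pair with `surj(3)`, for
  a colour `•`, K1's predicate `Theorems.SprungSharpFlatLowerDivisibility W 3 •` (the Eisenstein half
  «`ϖ·L^•` divides a generator of `char X^•`») IMPLIES Sprung's full Main Conjecture 1.3 / 7.21
  `Theorems.SprungSharpFlatMainConjecture W 3 •`** (each guarded by `L^• ≠ 0`), granted BY NAME the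
  published Sprung 2012 Thm. 7.14 (`h714`: `X^•` finitely generated `Λ`-torsion) and Thm. 7.16
  (`h716`: Kato's `gen ∣ L^•`, `n = 0` under `GL₂(ℤ₃)`-surjectivity) and the period unit at `3`
  (`h3`: `Ω_E = u·Ω⁺_f`, `|u|₃ = 1`, Mazur 1978 / Greenberg–Vatsal 2000). The `3`-adic surjectivity is
  NOT a binder: `surj(3)` at the good supersingular prime `3` gives it by Wuthrich 2014 Lemma 20, a
  KERNEL theorem (`Wuthrich2014.lemma20_surjective_threeAdic_of_semistable_holds`, fed through
  `Supersingular.surjective_pow_of_surj_of_good`). Proof = `Λ`-rigidity: `L^• ∣ gen` (K1, `ϖ ∈ ℤ₃^×`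
  by `X8_norm_periodRatio_eq_one`) and `gen ∣ L^•` (Kato) make `(gen) = (L^•) = (ϖ̃·L^•)`. NO analytic
  rank hypothesis, no `BSD(E,3)` input — contrast the rank-`0` squeeze of
  `K1Branch.sprungSharpFlatMainConjecture_of_bsdp` (which goes through `BSDp W 3` and (K•)).
* `X8.sprungSharpFlatMainConjecture_of_semistable_of_lowerDivisibility` — the same with NO image datum
  on X8 ∩ {sst} (`ClassX8.surj_of_semistable`, Serre 1972 Props. 12 + 21 i)).
* CLASS FORMS: `sprungMainConjecture_surjBranch_of_sprungLowerDivisibilityAtThree` — **K1 BY NAME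
  (`SprungLowerDivisibilityAtThree`, item 19875) gives Sprung's Main Conjecture at EVERY X8 pair with
  `surj(3)`, every colour, every analytic rank**, modulo `h714`, `h716`, `h3`; and conversely the main
  conjecture on the branch gives K1 there (`sprungSharpFlatLowerDivisibility_of_mainConjecture`, the
  leaf's own edge), so ON THE BIG-IMAGE BRANCH K1 ⟺ MC (`sprungLowerDivisibility_surjBranch_iff_mainConjecture_surjBranch`).

READING for the two planners (K3 `SignedLowerHalves`, print `PrintX8`). Crux 6 `SharpFlatResiduePPart`
(item 19004) declares the rank-ONE X8 pairs residual «because rank 1 needs the MAIN CONJECTURE + a ♯/♭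
Cor. A.5». On the 74 rank-one cells with `surj(3)` (all of them but one) the main conjecture is now K1 +
print (this file), and the ♯/♭ reading of Burungale–Kobayashi–Ota 2024 Cor. A.5 is being typed by the
print cell (ty1, p532534, `BurungaleKobayashiOta2024.corA5_pPart_of_sharpFlatCharIdeal_eq`, PUB*
composed citation): once it lands, 19004 restricted to `surj(3)` follows from 19875 modulo print, and
the print-tier residual of corner X8 is «K1 on `surj(3)`» + «the whole `3`-part on the 61 cells with
image the normaliser of a non-split Cartan» — nothing else. Beyond-print theorem: NO (compositions of
named facts; K1 stays OPEN: Sprung 2024 Thm. 1.1 needs his Conj. 3.33, CCSS arXiv:1804.10993 is PRE).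

References: [Sprung2012] Thm. 7.14, Thm. 7.16, Main Conj. 1.3 / 7.21 (pp. 1486, 1504–1505);
[Wuthrich2014] Lemma 20 (p. 399); [Serre1972] Props. 12, 21; [Mazur1978] Cor. 4.1;
[GreenbergVatsal2000] §3 Rem. 3.4; [Washington1997] §13.2 (`Λ` a UFD); cell table
`pub/bsd-ssimc/bsd-ssimc-plan/A8_x8_open_cells.v3.tsv`.
-/

set_option autoImplicit false
-- justification: the mandated namespace `Summit.BirchSwinnertonDyer.BirchSwinnertonDyer.Theorems`
-- (single-conjunct summit, Sub = Summit) repeats a segment by design (D-0017).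
set_option linter.dupNamespace false

noncomputable section

open scoped Classical NumberField MatrixGroups ModularForm
open NumberField IsDedekindDomain WeierstrassCurve CongruenceSubgroup
  Literature.NumberTheory.EllipticCurves Literature.NumberTheory.EllipticCurves.ModularForms
  Literature.NumberTheory.EllipticCurves.Rank1Residual
  Literature.NumberTheory.EllipticCurves.Sprung2017 Literature.NumberTheory.EllipticCurves.Sprung2012
  Literature.NumberTheory.EllipticCurves.ZpExtension
  Summit.BirchSwinnertonDyer.Rank1Residual.Supersingular
  Summit.BirchSwinnertonDyer.BirchSwinnertonDyer.Theses.SignedLowerHalves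

namespace Summit.BirchSwinnertonDyer.BirchSwinnertonDyer.Theorems

/-! ### §1. Per pair, rank-free: K1's predicate + Kato ⇒ Sprung's Main Conjecture on X8 ∩ {surj(3)} -/

/-- **X8 ∧ surj(3), ANY analytic rank, colour `•`: the Eisenstein half `SprungSharpFlatLowerDivisibility
W p •` gives Sprung's full ♯/♭ Main Conjecture 7.21 `SprungSharpFlatMainConjecture W p •` on the REAL
`X^•(E/ℚ_∞)`.** Named inputs (published): Sprung 2012 Thm. 7.14 (`h714`), Thm. 7.16 (`h716`, Kato's
half, `n = 0` from `3`-adic surjectivity = Wuthrich 2014 Lemma 20, a kernel theorem at the good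
supersingular prime `3`), the period unit at `3` (`h3`). `Λ`-rigidity: `L^• ∣ gen ∣ L^•`. PER PAIR;
closes nothing. [cite: Sprung2012, Thm. 7.14, Thm. 7.16 and Main Conj. 7.21 (pp. 1504–1505)]
[cite: Wuthrich2014, Lemma 20 (p. 399)] [cite: Washington1997, §13.2] -/
theorem X8.sprungSharpFlatMainConjecture_of_lowerDivisibility_of_surj
    (h714 : thm714_sharpFlatSelmerDual_finite_torsion)
    (h716 : thm716_sharpFlatCharIdeal_divisibility)
    (h3 : realPeriodRat_eq_unit_mul_plusPeriod_three)
    (W : WeierstrassCurve ℚ) [W.IsElliptic] [W.IsGloballyMinimal] (p : ℕ) [Fact p.Prime]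
    (hX : ClassX8 W p) (hs : Surj W p) (col : Chroma)
    (hK1 : SprungSharpFlatLowerDivisibility W p col) : SprungSharpFlatMainConjecture W p col := by
  intro κ γ hκ hγ hγ' v hv g hg cneg c hc N hN f ϖ Lsharp Lflat hf hϖ hSP hcol D
  haveI := hN
  have hp3 : p = 3 := hX.1
  subst hp3
  have hp2 : (3 : ℕ) ≠ 2 := by decide
  have hgood : W.HasGoodReductionAtPrime 3 := hX.2.1.1
  have hdvd : ((3 : ℕ) : ℤ) ∣ W.frobeniusTrace 3 := hX.2.1.2
  -- Sprung 2012 Thm. 7.14: `X^•` finitely generated and `Λ`-torsion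
  obtain ⟨hfinD, htorD⟩ :=
    h714 W 3 hp2 hgood hdvd f hf κ γ hκ hγ hγ' v hv g hg cneg c hc col Lsharp Lflat hSP hcol D
  haveI := hfinD
  -- K1 at the pair: `char X^• = (gen)`, `ι gen = ϖ · ι(L^• · h)`
  obtain ⟨gen, h, hchar, hι⟩ :=
    hK1 κ γ hκ hγ hγ' v hv g hg cneg c hc N hN f ϖ Lsharp Lflat hf hϖ hSP hcol D
  -- Kato (Sprung 2012 Thm. 7.16, `n = 0`): `gen ∣ L^•`; `3`-adic surjectivity from `surj(3)`
  have hsurj : ∀ n : ℕ, W.HasSurjectiveModNGaloisRep (3 ^ n : ℕ) :=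
    surjective_pow_of_surj_of_good W 3 Wuthrich2014.lemma20_surjective_threeAdic_of_semistable_holds
      hp2 hgood hs
  have hKato : gen ∣ chromaticL col Lsharp Lflat :=
    h716.dvd_of_charIdeal_eq_span hp2 hgood hdvd hf hκ hγ hγ' hv hg hc hSP hcol D htorD hsurj hchar
  -- `ϖ ∈ ℤ_3^×`, so `L^• ∣ gen`
  have hϖ1 : ‖(ϖ : ℚ_[3])‖ = 1 := X8_norm_periodRatio_eq_one h3 W 3 hX hf hϖ
  obtain ⟨-, hι'⟩ := span_C_units_mul_eq (PadicInt.mkUnits hϖ1) (chromaticL col Lsharp Lflat * h)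
  have hgen_eq : gen = PowerSeries.C ((PadicInt.mkUnits hϖ1 : ℤ_[3]ˣ) : ℤ_[3]) *
      (chromaticL col Lsharp Lflat * h) := by
    apply iwasawaToPowerSeries_injective 3
    rw [hι, hι', PadicInt.mkUnits_eq]
  have hLgen : chromaticL col Lsharp Lflat ∣ gen :=
    ⟨PowerSeries.C ((PadicInt.mkUnits hϖ1 : ℤ_[3]ˣ) : ℤ_[3]) * h, by rw [hgen_eq]; ring⟩
  have hspan : Ideal.span ({gen} : Set (IwasawaAlgebra 3)) =
      Ideal.span {chromaticL col Lsharp Lflat} :=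
    Ideal.span_singleton_eq_span_singleton.mpr (associated_of_dvd_dvd hKato hLgen)
  -- the Néron-normalised generator `ϖ̃ · L^•`
  obtain ⟨hspan', hι''⟩ := span_C_units_mul_eq (PadicInt.mkUnits hϖ1) (chromaticL col Lsharp Lflat)
  refine ⟨htorD, PowerSeries.C ((PadicInt.mkUnits hϖ1 : ℤ_[3]ˣ) : ℤ_[3]) *
    chromaticL col Lsharp Lflat, ?_, ?_⟩
  · rw [hchar, hspan, hspan']
  · rw [hι'', PadicInt.mkUnits_eq]

/-- **X8 ∩ {sst}, ANY analytic rank, colour `•`: K1's predicate gives Sprung's Main Conjecture, NO image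
datum** (`surj(3)` automatic for semistable X8 curves: Serre 1972 Props. 12 + 21 i),
`ClassX8.surj_of_semistable`). PER PAIR; closes nothing. [cite: Serre1972, §1.11 Prop. 12 and §5.4 Prop. 21 i)]
[cite: Sprung2012, Thm. 7.14, Thm. 7.16 and Main Conj. 7.21 (pp. 1504–1505)] -/
theorem X8.sprungSharpFlatMainConjecture_of_semistable_of_lowerDivisibility
    (h714 : thm714_sharpFlatSelmerDual_finite_torsion)
    (h716 : thm716_sharpFlatCharIdeal_divisibility)
    (h3 : realPeriodRat_eq_unit_mul_plusPeriod_three)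
    (W : WeierstrassCurve ℚ) [W.IsElliptic] [W.IsGloballyMinimal] (p : ℕ) [Fact p.Prime]
    (hX : ClassX8 W p) (hsst : Semistable W) (col : Chroma)
    (hK1 : SprungSharpFlatLowerDivisibility W p col) : SprungSharpFlatMainConjecture W p col := by
  have hs : Surj W p := by
    have hp3 : p = 3 := hX.1
    subst hp3
    exact ClassX8.surj_of_semistable W 3 hX hsst
  exact X8.sprungSharpFlatMainConjecture_of_lowerDivisibility_of_surj h714 h716 h3 W p hX hs col hK1

/-- **Per pair, both colours at once.** [cite: Sprung2012, Thm. 7.14, Thm. 7.16 and Main Conj. 7.21 (pp. 1504–1505)]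
[cite: Wuthrich2014, Lemma 20 (p. 399)] -/
theorem X8.sprungSharpFlatMainConjecture_iff_lowerDivisibility_of_surj
    (h714 : thm714_sharpFlatSelmerDual_finite_torsion)
    (h716 : thm716_sharpFlatCharIdeal_divisibility)
    (h3 : realPeriodRat_eq_unit_mul_plusPeriod_three)
    (W : WeierstrassCurve ℚ) [W.IsElliptic] [W.IsGloballyMinimal] (p : ℕ) [Fact p.Prime]
    (hX : ClassX8 W p) (hs : Surj W p) (col : Chroma) :
    SprungSharpFlatMainConjecture W p col ↔ SprungSharpFlatLowerDivisibility W p col :=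
  ⟨sprungSharpFlatLowerDivisibility_of_mainConjecture,
    X8.sprungSharpFlatMainConjecture_of_lowerDivisibility_of_surj h714 h716 h3 W p hX hs col⟩

/-! ### §2. Class forms: K1 BY NAME on the big-image branch of corner X8 -/

/-- **K1 BY NAME ⇒ Sprung's Main Conjecture on the whole big-image branch of X8, every rank, every
colour.** Granted Sprung 2012 Thms. 7.14 / 7.16 and the period unit at `3` (published named facts),
the crux child `SprungLowerDivisibilityAtThree` (item stmt-BirchSwinnertonDyer-19875) gives
`SprungSharpFlatMainConjecture W p •` at every X8 pair with `ρ̄_{E,3}` surjective (156 of the 217 census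
cells: all 74 + 82 big-image cells of both ranks). CONDITIONAL on K1; closes nothing.
[cite: Sprung2012, Thm. 7.14, Thm. 7.16 and Main Conj. 7.21 (pp. 1504–1505)] [cite: Wuthrich2014, Lemma 20 (p. 399)] -/
theorem sprungMainConjecture_surjBranch_of_sprungLowerDivisibilityAtThree
    (h714 : thm714_sharpFlatSelmerDual_finite_torsion)
    (h716 : thm716_sharpFlatCharIdeal_divisibility)
    (h3 : realPeriodRat_eq_unit_mul_plusPeriod_three)
    (hK1 : SprungLowerDivisibilityAtThree) :
    ∀ (W : WeierstrassCurve ℚ) [W.IsElliptic] [W.IsGloballyMinimal] (p : ℕ) [Fact p.Prime],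
      ClassX8 W p → Surj W p → ∀ col : Chroma, SprungSharpFlatMainConjecture W p col :=
  fun W _ _ p _ hX hs col ↦
    X8.sprungSharpFlatMainConjecture_of_lowerDivisibility_of_surj h714 h716 h3 W p hX hs col
      (hK1 W p hX col)

/-- **On the big-image branch of X8, K1 ⟺ the ♯/♭ Main Conjecture (class statement, every rank, both
colours)**, modulo Sprung 2012 Thms. 7.14 / 7.16 and the period unit at `3`. READING: restricted to
`surj(3)` the crux child K1 carries no less and no more than Sprung's Main Conjecture 7.21 itself; its
only `Λ`-adic surplus lives on the 61 non-surjective cells (where Kato's exponent `n` may be positive).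
[cite: Sprung2012, Thm. 7.14, Thm. 7.16 and Main Conj. 7.21 (pp. 1504–1505)] [cite: Wuthrich2014, Lemma 20 (p. 399)] -/
theorem sprungLowerDivisibility_surjBranch_iff_mainConjecture_surjBranch
    (h714 : thm714_sharpFlatSelmerDual_finite_torsion)
    (h716 : thm716_sharpFlatCharIdeal_divisibility)
    (h3 : realPeriodRat_eq_unit_mul_plusPeriod_three) :
    (∀ (W : WeierstrassCurve ℚ) [W.IsElliptic] [W.IsGloballyMinimal] (p : ℕ) [Fact p.Prime],
        ClassX8 W p → Surj W p → ∀ col : Chroma, SprungSharpFlatLowerDivisibility W p col) ↔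
      (∀ (W : WeierstrassCurve ℚ) [W.IsElliptic] [W.IsGloballyMinimal] (p : ℕ) [Fact p.Prime],
        ClassX8 W p → Surj W p → ∀ col : Chroma, SprungSharpFlatMainConjecture W p col) :=
  ⟨fun h W _ _ p _ hX hs col ↦
      X8.sprungSharpFlatMainConjecture_of_lowerDivisibility_of_surj h714 h716 h3 W p hX hs col
        (h W p hX hs col),
    fun h W _ _ p _ hX hs col ↦ sprungSharpFlatLowerDivisibility_of_mainConjecture (h W p hX hs col)⟩

/-- **K1 BY NAME, decomposed by image** (pure logic): `SprungLowerDivisibilityAtThree` ⟺ (K1 on the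
big-image branch) ∧ (K1 on the non-surjective X8 pairs). With the previous theorem the first conjunct
is the ♯/♭ Main Conjecture on `surj(3)`. [cite: Sprung2012, Main Conj. 7.21 (p. 1505)] -/
theorem sprungLowerDivisibilityAtThree_iff_surj_and_nonSurj :
    SprungLowerDivisibilityAtThree ↔
      ((∀ (W : WeierstrassCurve ℚ) [W.IsElliptic] [W.IsGloballyMinimal] (p : ℕ) [Fact p.Prime],
          ClassX8 W p → Surj W p → ∀ col : Chroma, SprungSharpFlatLowerDivisibility W p col) ∧
        (∀ (W : WeierstrassCurve ℚ) [W.IsElliptic] [W.IsGloballyMinimal] (p : ℕ) [Fact p.Prime],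
          ClassX8 W p → ¬ Surj W p → ∀ col : Chroma, SprungSharpFlatLowerDivisibility W p col)) := by
  unfold SprungLowerDivisibilityAtThree
  refine ⟨fun h ↦ ⟨fun W _ _ p _ hX _ col ↦ h W p hX col, fun W _ _ p _ hX _ col ↦ h W p hX col⟩,
    fun ⟨h1, h2⟩ W _ _ p _ hX col ↦ ?_⟩
  by_cases hs : Surj W p
  · exact h1 W p hX hs col
  · exact h2 W p hX hs col

/-- **K1 BY NAME gives the Main Conjecture on the big-image branch AND K1 off it** — the form the
print cell's assembly consumes (big image: MC, hence `BSD(E,3)` in rank `0` by the K3 branch theorem and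
in rank `1` by the ♯/♭ reading of BKO 2024 Cor. A.5; small image: K1 stays `Λ`-adic).
[cite: Sprung2012, Thm. 7.14, Thm. 7.16 and Main Conj. 7.21 (pp. 1504–1505)] [cite: Wuthrich2014, Lemma 20 (p. 399)] -/
theorem mainConjecture_surj_and_lowerDivisibility_nonSurj_of_sprungLowerDivisibilityAtThree
    (h714 : thm714_sharpFlatSelmerDual_finite_torsion)
    (h716 : thm716_sharpFlatCharIdeal_divisibility)
    (h3 : realPeriodRat_eq_unit_mul_plusPeriod_three)
    (hK1 : SprungLowerDivisibilityAtThree) :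
    (∀ (W : WeierstrassCurve ℚ) [W.IsElliptic] [W.IsGloballyMinimal] (p : ℕ) [Fact p.Prime],
        ClassX8 W p → Surj W p → ∀ col : Chroma, SprungSharpFlatMainConjecture W p col) ∧
      (∀ (W : WeierstrassCurve ℚ) [W.IsElliptic] [W.IsGloballyMinimal] (p : ℕ) [Fact p.Prime],
        ClassX8 W p → ¬ Surj W p → ∀ col : Chroma, SprungSharpFlatLowerDivisibility W p col) :=
  ⟨sprungMainConjecture_surjBranch_of_sprungLowerDivisibilityAtThree h714 h716 h3 hK1,
    fun W _ _ p _ hX _ col ↦ hK1 W p hX col⟩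

end Summit.BirchSwinnertonDyer.BirchSwinnertonDyer.Theorems

end
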